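import Literature.MathematicalPhysics.QuantumLattice.HubbardHubbardModelEtaODLROProofs
import Literature.MathematicalPhysics.QuantumLattice.FinDimSpectrumSectorGibbsLimit
import Literature.MathematicalPhysics.QuantumLattice.DWaveSourceProofs
import Literature.MathematicalPhysics.QuantumLattice.SectorSpectrum
import Literature.MathematicalPhysics.QuantumLattice.HubbardModelParticleHoleProofs
import Literature.MathematicalPhysics.QuantumLattice.LiebFluxPhaseProofs
import Summits.HubbardSuperconductivity.HubbardSuperconductivity.Theorems.ThermalWedgeTwSeededEnsembleEquivalenceBarrierEtaTower
import Summits.HubbardSuperconductivity.HubbardSuperconductivity.Theorems.ThermalWedgeTwSeededEnsembleEquivalenceBarrierPolarised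

/-!
# Crux `TwSeededEnsembleEquivalence` (stmt-HubbardSuperconductivity-1698), line `exposed-density-duality` —
# STRUCTURAL BARRIER 2/2: gap theorem and failure of the crux-shaped statement (registered stub `stub_structuralBarrierOfSectorBound`)

Continuation of part 1/2 (`…BarrierSectorBound`: the sector lower bound, taken here as the HYPOTHESIS `hSB` so that both
parts land in one build cycle; the skeleton composes them). From the landed barrier stubs `stub_etaTowerTrialState` (Yang's
tower `(ηᴴ)^m|0⟩` is an exact eigenvector of `HsCan`) and `stub_singlyOccupiedTrialState` (polarised configurations are zero
modes): grand-canonical upper bounds `E₀(HsCan − μN̂) ≤ Um − (g/L²)2m(L² − m + 1) − 2mμ` and `≤ −μN`; the GAP THEOREM (for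
every `U₀ > 0`: `g = min(1/10, U₀/2)`, `U = 7g/5` give, against EVERY slope `μ` and for all `L ≥ 10`, a hull gap
`≥ (g/100)L²` at density `7/10`, i.e. `δ = 3/10`); and its consequences: the T = 0 hull-touch shape (refuter Template C) and the
VERBATIM SHAPE of `TwSeededEnsembleEquivalence` (with `t = 0` and the on-site seed) are FALSE for this member of the structural
class {finite-range repulsive lattice fermions + separable attractive pair seed}. Reading: any proof of the crux must use the
dispersive weak-coupling (`t = 1`) input — the T = 0 phase diagram —, and the narrowing `g ≥ K·U` (all the engine
`twSeededRung_structural` consumes) removes the counterexample (`U/(2g) ∈ (1/2,1)` is needed). No definitions; everything is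
proved. Yang, PRL 63 (1989) 2144; Yang–Zhang, Mod. Phys. Lett. B4 (1990) 759.
-/

set_option linter.dupNamespace false

namespace Summit.HubbardSuperconductivity.HubbardSuperconductivity.Theorems.TwSeededEnsembleEquivalence.ExposedDensity

open Matrix Finset Literature.MathematicalPhysics.QuantumLattice Literature.Probability.LatticeModels
open scoped ComplexOrder Matrix.Norms.L2Operator

noncomputable section

namespace StructuralBarrier

variable (L : ℕ)

/-! ### Grand-canonical upper bounds from the trial states -/

/-- The seeded grand-canonical atomic Hamiltonian is Hermitian. [folklore] -/
theorem isHermitian_HsGc (L : ℕ) [NeZero L] (U μ g : ℝ) :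
    (hubbardTorusWith 2 L 0 U μ - ((g / (L : ℝ) ^ 2 : ℝ) : ℂ) •
      ((pairField sWave L)ᴴ * pairField sWave L)).IsHermitian := by
  refine (isHermitian_hubbardTorusWith L 0 U μ).sub ?_
  have hP : ((pairField sWave L)ᴴ * pairField sWave L).IsHermitian := isHermitian_conjTranspose_mul_self _
  unfold Matrix.IsHermitian at hP ⊢
  rw [conjTranspose_smul, hP, Complex.star_def, Complex.conj_ofReal]

/-- Rayleigh quotient of a normalised eigenvector with real eigenvalue. [folklore] -/
theorem groundEnergy_le_of_eigenvector {ι : Type*} [Fintype ι] [DecidableEq ι] {A : Matrix ι ι ℂ}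
    (hA : A.IsHermitian) {v : ι → ℂ} (hv : v ≠ 0) {lam : ℝ} (hAv : A *ᵥ v = ((lam : ℝ) : ℂ) • v) :
    A.groundEnergy ≤ lam := by
  haveI : Nonempty ι := by
    by_contra h
    rw [not_nonempty_iff] at h
    exact hv (funext fun i => (IsEmpty.false i).elim)
  obtain ⟨c, -, hc1⟩ := exists_smul_unit hv
  have hle := Matrix.groundEnergy_le_rayleigh_holds hA (c • v) hc1
  have hray : (star (c • v) ⬝ᵥ A *ᵥ (c • v)).re = lam := by
    rw [mulVec_smul, hAv, smul_smul, mul_comm, ← smul_smul, dotProduct_smul, hc1, smul_eq_mul,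
      mul_one, Complex.ofReal_re]
  rwa [hray] at hle

/-- **GC upper bound from the η-tower** (stub B2): `E₀(HsGc(μ)) ≤ Um − (g/L²)·2m(L² − m + 1) − 2mμ` for `m ≤ L²`.
[cite: Yang1989, eqs. (7)–(11)] -/
theorem groundEnergy_gc_le_tower
    (L : ℕ) [NeZero L] (U μ g : ℝ) (m : ℕ) (hm : m ≤ L ^ 2) :
    (hubbardTorusWith 2 L 0 U μ - ((g / (L : ℝ) ^ 2 : ℝ) : ℂ) •
      ((pairField sWave L)ᴴ * pairField sWave L)).groundEnergy ≤
      U * m - g / (L : ℝ) ^ 2 * (2 * m * ((L : ℝ) ^ 2 - m + 1)) - μ * (2 * m) := by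
  obtain ⟨hne, hN, hev⟩ := stub_etaTowerTrialState L U g m hm
  refine groundEnergy_le_of_eigenvector (isHermitian_HsGc L U μ g) hne ?_
  rw [hubbardTorusWith_eq, sub_right_comm, sub_mulVec, hev, smul_mulVec,
    totalNumber_mulVec_of_isNParticle hN, smul_smul, ← sub_smul]
  congr 1
  push_cast
  ring

/-- **GC upper bound from the polarised configurations** (stub B3): `E₀(HsGc(μ)) ≤ −μN` for `N ≤ L²`. [folklore] -/
theorem groundEnergy_gc_le_polarised
    (L : ℕ) [NeZero L] (U μ g : ℝ) (N : ℕ) (hN : N ≤ L ^ 2) :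
    (hubbardTorusWith 2 L 0 U μ - ((g / (L : ℝ) ^ 2 : ℝ) : ℂ) •
      ((pairField sWave L)ᴴ * pairField sWave L)).groundEnergy ≤ -(μ * N) := by
  obtain ⟨ψ, hψ1, hψN, hψ0⟩ := stub_singlyOccupiedTrialState L U g N hN
  have hne : ψ ≠ 0 := by
    intro h
    rw [h, star_zero, zero_dotProduct] at hψ1
    exact zero_ne_one hψ1
  refine groundEnergy_le_of_eigenvector (isHermitian_HsGc L U μ g) hne ?_
  rw [hubbardTorusWith_eq, sub_right_comm, sub_mulVec, hψ0, smul_mulVec,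
    totalNumber_mulVec_of_isNParticle hψN, smul_smul, zero_sub, ← neg_smul]
  congr 1
  push_cast
  ring


end StructuralBarrier

open StructuralBarrier

/-! ### The gap theorem -/

/-- **STRUCTURAL BARRIER — the gap theorem.** For every `U₀ > 0` there are admissible `U ∈ (0, U₀]`, `g ∈ (0, 1/10]`
(`g = min(1/10, U₀/2)`, `U = 7g/5`) such that for EVERY slope `μ` and all `L ≥ 10` the `(N_L, S^z = 0)`-sector energy of
the seeded atomic model at density `7/10` exceeds the supporting line of slope `μ` through the grand-canonical ground energy
by at least `(g/100)L²`: `E₀(HsGc(μ)) + (g/100)L² ≤ minEnergyOn(HsCan, szSector N_L 0) − μN_L`, `N_L = 2⌊(1 − 3/10)L²/2⌋₊`.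
(Sector energy `≥ 0` by the sector lower bound; `E₀(HsGc(μ)) ≤ −μL²` (polarised, used for `μ ≥ g/20`) and
`≤ Um − (g/L²)2m(L² − m + 1) − 2mμ` with `m = ⌊3L²/20⌋` (η tower, used for `μ < g/20`).) [folklore] -/
theorem stub_structuralBarrierOfSectorBound :
    (∀ (L : ℕ) [NeZero L] (U g : ℝ) (N : ℕ) (M : ℝ), 0 ≤ g →
      min 0 (U * N / 2 - g / (L : ℝ) ^ 2 * N * ((L : ℝ) ^ 2 - N / 2 + 1)) ≤
        (hubbardTorus 2 L 0 U - ((g / (L : ℝ) ^ 2 : ℝ) : ℂ) •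
          ((pairField sWave L)ᴴ * pairField sWave L)).minEnergyOn (szSector (Λ := FermionTorus 2 L) N M)) →
    ∀ U₀ : ℝ, 0 < U₀ → ∃ U ∈ Set.Ioc (0 : ℝ) U₀, ∃ g ∈ Set.Ioc (0 : ℝ) (1 / 10), ∀ μ : ℝ, ∃ L₀ : ℕ,
      ∀ (L : ℕ) [NeZero L], L₀ ≤ L →
        (hubbardTorusWith 2 L 0 U μ - ((g / (L : ℝ) ^ 2 : ℝ) : ℂ) •
          ((pairField sWave L)ᴴ * pairField sWave L)).groundEnergy + g / 100 * (L : ℝ) ^ 2 ≤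
        (hubbardTorus 2 L 0 U - ((g / (L : ℝ) ^ 2 : ℝ) : ℂ) •
          ((pairField sWave L)ᴴ * pairField sWave L)).minEnergyOn
            (szSector (Λ := FermionTorus 2 L) (2 * ⌊(1 - 3 / 10) * (L : ℝ) ^ 2 / 2⌋₊) 0) -
          μ * ((2 * ⌊(1 - 3 / 10) * (L : ℝ) ^ 2 / 2⌋₊ : ℕ) : ℝ) := by
  intro hSB U₀ hU₀
  set g : ℝ := min (1 / 10) (U₀ / 2) with hgdef
  have hg0 : 0 < g := lt_min (by norm_num) (by linarith)
  have hg10 : g ≤ 1 / 10 := min_le_left _ _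
  have hgU : g ≤ U₀ / 2 := min_le_right _ _
  refine ⟨7 / 5 * g, ⟨by positivity, by linarith⟩, g, ⟨hg0, hg10⟩, fun μ => ⟨10, fun L _ hL => ?_⟩⟩
  -- sizes
  have hL : (10 : ℝ) ≤ L := by exact_mod_cast hL
  have hL2 : (100 : ℝ) ≤ (L : ℝ) ^ 2 := by nlinarith
  have hLpos : (0 : ℝ) < (L : ℝ) ^ 2 := by positivity
  set N : ℕ := 2 * ⌊(1 - 3 / 10) * (L : ℝ) ^ 2 / 2⌋₊ with hNdef
  have hx0 : (0 : ℝ) ≤ (1 - 3 / 10) * (L : ℝ) ^ 2 / 2 := by positivity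
  have hNle : (N : ℝ) ≤ 7 / 10 * (L : ℝ) ^ 2 := by
    have h := Nat.floor_le hx0
    rw [hNdef]; push_cast; linarith
  have hNge : 7 / 10 * (L : ℝ) ^ 2 - 2 ≤ N := by
    have h := Nat.lt_floor_add_one ((1 - 3 / 10) * (L : ℝ) ^ 2 / 2)
    rw [hNdef]; push_cast; linarith
  -- lower bound on the sector energy: the `min` is `0`
  have hlow := hSB L (7 / 5 * g) g N 0 hg0.le
  have hmin : min 0 (7 / 5 * g * N / 2 - g / (L : ℝ) ^ 2 * N * ((L : ℝ) ^ 2 - N / 2 + 1)) = 0 := by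
    apply min_eq_left
    have h2 : 7 / 5 * g * N / 2 - g / (L : ℝ) ^ 2 * N * ((L : ℝ) ^ 2 - N / 2 + 1) =
        g * N / (2 * (L : ℝ) ^ 2) * (N - 3 / 5 * (L : ℝ) ^ 2 - 2) := by
      field_simp
      ring
    rw [h2]
    apply mul_nonneg (by positivity)
    nlinarith
  rw [hmin] at hlow
  -- upper bounds on the GC ground energy, by cases on μ
  by_cases hμ : g / 20 ≤ μ
  · -- polarised configurations at full filling `N₂ = L²`
    have hup := groundEnergy_gc_le_polarised L (7 / 5 * g) μ g (L ^ 2) le_rfl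
    have hcast : ((L ^ 2 : ℕ) : ℝ) = (L : ℝ) ^ 2 := by push_cast; ring
    rw [hcast] at hup
    have hμ0 : 0 ≤ μ := by linarith [hg0]
    have h1 : g / 100 * (L : ℝ) ^ 2 ≤ μ * (L : ℝ) ^ 2 - μ * N := by
      have h2 : g / 20 * (3 / 10 * (L : ℝ) ^ 2) ≤ μ * ((L : ℝ) ^ 2 - N) :=
        mul_le_mul hμ (by linarith) (by positivity) hμ0
      nlinarith
    generalize (hubbardTorusWith 2 L 0 (7 / 5 * g) μ - ((g / (L : ℝ) ^ 2 : ℝ) : ℂ) •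
        ((pairField sWave L)ᴴ * pairField sWave L)).groundEnergy = E0 at hup ⊢
    generalize (hubbardTorus 2 L 0 (7 / 5 * g) - ((g / (L : ℝ) ^ 2 : ℝ) : ℂ) •
        ((pairField sWave L)ᴴ * pairField sWave L)).minEnergyOn
          (szSector (Λ := FermionTorus 2 L) N 0) = ME at hlow ⊢
    linarith only [hup, h1, hlow]
  · push Not at hμ
    -- η tower with `m = ⌊3L²/20⌋` pairs
    set m : ℕ := ⌊(3 : ℝ) / 20 * (L : ℝ) ^ 2⌋₊ with hmdef
    have hy0 : (0 : ℝ) ≤ 3 / 20 * (L : ℝ) ^ 2 := by positivity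
    have hmle : (m : ℝ) ≤ 3 / 20 * (L : ℝ) ^ 2 := Nat.floor_le hy0
    have hmge : 3 / 20 * (L : ℝ) ^ 2 - 1 ≤ m := by
      have h := Nat.lt_floor_add_one ((3 : ℝ) / 20 * (L : ℝ) ^ 2)
      linarith
    have hm0 : (0 : ℝ) ≤ m := Nat.cast_nonneg m
    have hmL : m ≤ L ^ 2 := by
      have h : (m : ℝ) ≤ ((L ^ 2 : ℕ) : ℝ) := by push_cast; nlinarith
      exact_mod_cast h
    have hup := groundEnergy_gc_le_tower L (7 / 5 * g) μ g m hmL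
    -- the seed gain dominates the pairing cost and the entropy-free gap budget
    have hA : 17 / 10 * g * m ≤ g / (L : ℝ) ^ 2 * (2 * m * ((L : ℝ) ^ 2 - m + 1)) := by
      have h2 : g / (L : ℝ) ^ 2 * (2 * m * ((L : ℝ) ^ 2 - m + 1)) - 17 / 10 * g * m =
          g * m / (L : ℝ) ^ 2 * (3 / 10 * (L : ℝ) ^ 2 - 2 * m + 2) := by
        field_simp
        ring
      have h3 : 0 ≤ g * m / (L : ℝ) ^ 2 * (3 / 10 * (L : ℝ) ^ 2 - 2 * m + 2) :=
        mul_nonneg (by positivity) (by nlinarith)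
      linarith
    have hNm : (N : ℝ) - 2 * m ≤ 2 / 5 * (L : ℝ) ^ 2 + 2 := by linarith
    have hNm0 : 0 ≤ (N : ℝ) - 2 * m := by linarith
    have h4 : g * (3 / 20 * (L : ℝ) ^ 2 - 1) ≤ g * m := mul_le_mul_of_nonneg_left hmge hg0.le
    have h5 : g * 100 ≤ g * (L : ℝ) ^ 2 := mul_le_mul_of_nonneg_left hL2 hg0.le
    have hg20 : (0 : ℝ) ≤ g / 20 := div_nonneg hg0.le (by norm_num)
    generalize (hubbardTorusWith 2 L 0 (7 / 5 * g) μ - ((g / (L : ℝ) ^ 2 : ℝ) : ℂ) •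
        ((pairField sWave L)ᴴ * pairField sWave L)).groundEnergy = E0 at hup ⊢
    generalize (hubbardTorus 2 L 0 (7 / 5 * g) - ((g / (L : ℝ) ^ 2 : ℝ) : ℂ) •
        ((pairField sWave L)ᴴ * pairField sWave L)).minEnergyOn
          (szSector (Λ := FermionTorus 2 L) N 0) = ME at hlow ⊢
    generalize g / (L : ℝ) ^ 2 * (2 * m * ((L : ℝ) ^ 2 - m + 1)) = X at hup hA ⊢
    rcases le_or_gt μ 0 with hμ0 | hμ0
    · have h1 : μ * N - μ * (2 * m) ≤ 0 := by
        have : μ * ((N : ℝ) - 2 * m) ≤ 0 := mul_nonpos_of_nonpos_of_nonneg hμ0 hNm0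
        linarith
      linarith only [hup, hA, h4, h5, h1, hlow, hg0]
    · have h1 : μ * N - μ * (2 * m) ≤ g / 20 * (2 / 5 * (L : ℝ) ^ 2 + 2) := by
        have h2 : μ * ((N : ℝ) - 2 * m) ≤ g / 20 * ((N : ℝ) - 2 * m) :=
          mul_le_mul_of_nonneg_right hμ.le hNm0
        have h3 : g / 20 * ((N : ℝ) - 2 * m) ≤ g / 20 * (2 / 5 * (L : ℝ) ^ 2 + 2) :=
          mul_le_mul_of_nonneg_left hNm hg20
        linarith
      linarith only [hup, hA, h4, h5, h1, hlow, hg0]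


/-! ### Consequences: the crux-shaped statements fail for this member of the structural class -/

/-- **The T = 0 hull-touch-shaped statement (refuter Template C, `HullTouchT0Strong`, written for the atomic s-wave-seeded
torus) is FALSE.** [folklore] -/
theorem not_hullTouchShape_atomic_sWave_of_sectorBound
    (hSB : ∀ (L : ℕ) [NeZero L] (U g : ℝ) (N : ℕ) (M : ℝ), 0 ≤ g →
      min 0 (U * N / 2 - g / (L : ℝ) ^ 2 * N * ((L : ℝ) ^ 2 - N / 2 + 1)) ≤
        (hubbardTorus 2 L 0 U - ((g / (L : ℝ) ^ 2 : ℝ) : ℂ) •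
          ((pairField sWave L)ᴴ * pairField sWave L)).minEnergyOn (szSector (Λ := FermionTorus 2 L) N M)) :
    ¬ (∀ δ ∈ Set.Icc (1/10 : ℝ) (2/5 : ℝ), ∃ μ₁ μ₂ : ℝ, -4 < μ₁ ∧ μ₁ ≤ μ₂ ∧ μ₂ < 0 ∧ ∃ U₀ : ℝ, 0 < U₀ ∧
      ∀ U ∈ Set.Ioc (0 : ℝ) U₀, ∀ g ∈ Set.Ioc (0 : ℝ) (1 / 10),
        ∃ μ ∈ Set.Icc μ₁ μ₂, ∀ κ : ℝ, 0 < κ → ∃ L₀ : ℕ, ∀ (L : ℕ) [NeZero L], L₀ ≤ L →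
          (hubbardTorus 2 L 0 U - ((g / (L : ℝ) ^ 2 : ℝ) : ℂ) •
            ((pairField sWave L)ᴴ * pairField sWave L)).minEnergyOn
              (szSector (Λ := FermionTorus 2 L) (2 * ⌊(1 - δ) * (L : ℝ) ^ 2 / 2⌋₊) 0) -
            μ * ((2 * ⌊(1 - δ) * (L : ℝ) ^ 2 / 2⌋₊ : ℕ) : ℝ) ≤
          (hubbardTorusWith 2 L 0 U μ - ((g / (L : ℝ) ^ 2 : ℝ) : ℂ) •
            ((pairField sWave L)ᴴ * pairField sWave L)).groundEnergy + κ * (L : ℝ) ^ 2) := by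
  intro h
  obtain ⟨μ₁, μ₂, -, -, -, U₀, hU₀, hU⟩ := h (3 / 10) ⟨by norm_num, by norm_num⟩
  obtain ⟨U, hUm, g, hgm, hbar⟩ := stub_structuralBarrierOfSectorBound hSB U₀ hU₀
  obtain ⟨μ, -, hμ⟩ := hU U hUm g hgm
  obtain ⟨L₁, hL₁⟩ := hμ (g / 200) (by linarith [hgm.1])
  obtain ⟨L₂, hL₂⟩ := hbar μ
  haveI hNZ : NeZero (max (max L₁ L₂) 1) := ⟨by positivity⟩
  have hA := hL₁ (max (max L₁ L₂) 1) (le_trans (le_max_left _ _) (le_max_left _ _))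
  have hB := hL₂ (max (max L₁ L₂) 1) (le_trans (le_max_right _ _) (le_max_left _ _))
  have hLpos : (0 : ℝ) < ((max (max L₁ L₂) 1 : ℕ) : ℝ) ^ 2 := by positivity
  have hgL : 0 < g * (((max (max L₁ L₂) 1 : ℕ) : ℝ) ^ 2) := mul_pos hgm.1 hLpos
  generalize (((max (max L₁ L₂) 1 : ℕ)) : ℝ) = Lr at hA hB hLpos hgL
  generalize (hubbardTorusWith 2 (max (max L₁ L₂) 1) 0 U μ -
      ((g / Lr ^ 2 : ℝ) : ℂ) • ((pairField sWave (max (max L₁ L₂) 1))ᴴ *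
        pairField sWave (max (max L₁ L₂) 1))).groundEnergy = E0 at hA hB
  generalize (hubbardTorus 2 (max (max L₁ L₂) 1) 0 U - ((g / Lr ^ 2 : ℝ) : ℂ) •
      ((pairField sWave (max (max L₁ L₂) 1))ᴴ * pairField sWave (max (max L₁ L₂) 1))).minEnergyOn
        (szSector (Λ := FermionTorus 2 (max (max L₁ L₂) 1)) (2 * ⌊(1 - 3 / 10) * Lr ^ 2 / 2⌋₊) 0) = ME at hA hB
  generalize ((2 * ⌊(1 - 3 / 10) * Lr ^ 2 / 2⌋₊ : ℕ) : ℝ) = Nr at hA hB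
  linarith

/-- **The crux-shaped statement itself (the verbatim shape of `TwSeededEnsembleEquivalence`, with `hubbardTorus 2 L 0 U`,
`hubbardTorusWith 2 L 0 U μ` and the on-site seed `pairField sWave L` in place of `t = 1` and the d-wave seed) is FALSE**:
with `Z_β ≥ e^{−βE₀}` the thermal statement at `β = max 1 (400 log 4/g)`, `ε = g/400` would give the hull touch within
`(g/200)L²` at its `μ`, against the gap theorem. [folklore] -/
theorem not_cruxShape_atomic_sWave_of_sectorBound
    (hSB : ∀ (L : ℕ) [NeZero L] (U g : ℝ) (N : ℕ) (M : ℝ), 0 ≤ g →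
      min 0 (U * N / 2 - g / (L : ℝ) ^ 2 * N * ((L : ℝ) ^ 2 - N / 2 + 1)) ≤
        (hubbardTorus 2 L 0 U - ((g / (L : ℝ) ^ 2 : ℝ) : ℂ) •
          ((pairField sWave L)ᴴ * pairField sWave L)).minEnergyOn (szSector (Λ := FermionTorus 2 L) N M)) :
    ¬ (∀ δ ∈ Set.Icc (1/10 : ℝ) (2/5 : ℝ), ∃ μ₁ μ₂ : ℝ, -4 < μ₁ ∧ μ₁ ≤ μ₂ ∧ μ₂ < 0 ∧ ∃ U₀ : ℝ, 0 < U₀ ∧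
      ∀ U ∈ Set.Ioc (0 : ℝ) U₀, ∀ g ∈ Set.Ioc (0 : ℝ) (1 / 10), ∀ β : ℝ, 1 ≤ β → ∃ μ ∈ Set.Icc μ₁ μ₂,
        ∀ ε : ℝ, 0 < ε → ∃ L₀ : ℕ, ∀ (L : ℕ) [NeZero L], L₀ ≤ L →
          ((hubbardTorus 2 L 0 U - ((g / (L : ℝ) ^ 2 : ℝ) : ℂ) •
            ((pairField sWave L)ᴴ * pairField sWave L)).minEnergyOn
              (szSector (Λ := FermionTorus 2 L) (2 * ⌊(1 - δ) * (L : ℝ) ^ 2 / 2⌋₊) 0) / (L : ℝ) ^ 2) +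
            (Real.log (Matrix.partitionFn β (hubbardTorusWith 2 L 0 U μ - ((g / (L : ℝ) ^ 2 : ℝ) : ℂ) •
              ((pairField sWave L)ᴴ * pairField sWave L))).re / (β * (L : ℝ) ^ 2)) -
            μ * ((2 * ⌊(1 - δ) * (L : ℝ) ^ 2 / 2⌋₊) : ℝ) / (L : ℝ) ^ 2 ≤ Real.log 4 / β + ε) := by
  intro h
  obtain ⟨μ₁, μ₂, -, -, -, U₀, hU₀, hU⟩ := h (3 / 10) ⟨by norm_num, by norm_num⟩
  obtain ⟨U, hUm, g, hgm, hbar⟩ := stub_structuralBarrierOfSectorBound hSB U₀ hU₀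
  have hg0 : 0 < g := hgm.1
  have hlog4 : 0 < Real.log 4 := Real.log_pos (by norm_num)
  set β : ℝ := max 1 (400 * Real.log 4 / g) with hβdef
  have hβ1 : 1 ≤ β := le_max_left _ _
  have hβpos : 0 < β := lt_of_lt_of_le one_pos hβ1
  have hslack : Real.log 4 / β ≤ g / 400 := by
    rw [div_le_iff₀ hβpos]
    have h1 : 400 * Real.log 4 / g ≤ β := le_max_right _ _
    rw [div_le_iff₀ hg0] at h1
    linarith
  obtain ⟨μ, -, hμ⟩ := hU U hUm g hgm β hβ1
  obtain ⟨L₁, hL₁⟩ := hμ (g / 400) (by positivity)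
  obtain ⟨L₂, hL₂⟩ := hbar μ
  haveI hNZ : NeZero (max (max L₁ L₂) 1) := ⟨by positivity⟩
  have hA := hL₁ (max (max L₁ L₂) 1) (le_trans (le_max_left _ _) (le_max_left _ _))
  have hB := hL₂ (max (max L₁ L₂) 1) (le_trans (le_max_right _ _) (le_max_left _ _))
  -- abbreviate
  have hZ := exp_neg_mul_groundEnergy_le_partitionFn (isHermitian_HsGc (max (max L₁ L₂) 1) U μ g) β
  have hLr1 : (1 : ℝ) ≤ (((max (max L₁ L₂) 1 : ℕ)) : ℝ) := by exact_mod_cast le_max_right _ _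
  generalize (((max (max L₁ L₂) 1 : ℕ)) : ℝ) = Lr at hA hB hZ hLr1
  have hLpos : (0 : ℝ) < Lr ^ 2 := by positivity
  generalize (hubbardTorusWith 2 (max (max L₁ L₂) 1) 0 U μ -
      ((g / Lr ^ 2 : ℝ) : ℂ) • ((pairField sWave (max (max L₁ L₂) 1))ᴴ *
        pairField sWave (max (max L₁ L₂) 1))) = Hgc at hA hB hZ
  generalize (hubbardTorus 2 (max (max L₁ L₂) 1) 0 U - ((g / Lr ^ 2 : ℝ) : ℂ) •
      ((pairField sWave (max (max L₁ L₂) 1))ᴴ * pairField sWave (max (max L₁ L₂) 1))).minEnergyOn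
        (szSector (Λ := FermionTorus 2 (max (max L₁ L₂) 1)) (2 * ⌊(1 - 3 / 10) * Lr ^ 2 / 2⌋₊) 0) = ME at hA hB
  push_cast at hB
  generalize ((⌊(1 - 3 / 10) * Lr ^ 2 / 2⌋₊ : ℕ) : ℝ) = nr at hA hB
  -- `log Re Z ≥ −β E₀`
  have hlogZ : -(β * Hgc.groundEnergy) ≤ Real.log (Hgc.partitionFn β).re := by
    calc -(β * Hgc.groundEnergy) = Real.log (Real.exp (-(β * Hgc.groundEnergy))) := (Real.log_exp _).symm
      _ ≤ Real.log (Hgc.partitionFn β).re := Real.log_le_log (Real.exp_pos _) hZ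
  have hp : -(Hgc.groundEnergy / Lr ^ 2) ≤ Real.log (Hgc.partitionFn β).re / (β * Lr ^ 2) := by
    rw [le_div_iff₀ (mul_pos hβpos hLpos)]
    have : -(Hgc.groundEnergy / Lr ^ 2) * (β * Lr ^ 2) = -(β * Hgc.groundEnergy) := by
      field_simp
    linarith
  -- from the thermal statement: ME − μ N ≤ E₀ + (g/200) L²
  have h1 : ME / Lr ^ 2 - Hgc.groundEnergy / Lr ^ 2 - μ * (2 * nr) / Lr ^ 2 ≤ g / 400 + g / 400 := by
    linarith
  have h2 : (ME - Hgc.groundEnergy - μ * (2 * nr)) / Lr ^ 2 ≤ g / 200 := by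
    rw [sub_div, sub_div]; linarith
  rw [div_le_iff₀ hLpos] at h2
  nlinarith


end

end Summit.HubbardSuperconductivity.HubbardSuperconductivity.Theorems.TwSeededEnsembleEquivalence.ExposedDensity
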